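import Summits.QuantumFields.YangMills.Theorems.FlatTubeReductionProfileDressingPackageR
import Summits.QuantumFields.YangMills.Theorems.FlatTubeReductionDressedHTEventuallyR
import HarnessLib

/-!
# ★★★★ THE hN AND hT FIELDS OF `RateTube.AnalyticRatePotInput` FOR THE SHARED PROFILE OF RECORD: the normalised cap-balanced stiff Gaussian profile `n_β(u)·recordProfile L β (x)` at
# fibre radius `r_B = min (1/40) (β^{-1/2}·btLog β)`, with its dressing `W_β`, exact fibre mass `γ_β`, scale `σ_β` and rate `κ_β = O(λ_b(L³β)²)` — all STRUCTURAL fields of the analytic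
# input (`hΩm hΩ1 hΩinv hΩr hWphys hW0 hWbU hκW hWsq hr hr_small hγ hσ hκ0 hκ_small`) together with `hN` (exact: `|mass − γ| = 0`) and `hT` (the dressed (B-T) brick at rate)
# (route `FlatTubeReduction`, crux K1 `NearFlatRatioLaw` stmt-QuantumFields-24720; seat `ym-line-ftr-p1` g17; rate twin «ratepack-v5»; R2b1 RECORD rung — no summit statement is proved here)

WHY (memo `Cruxes/NearFlatRatioLaw/Lines/ratepack-v5-nearpair-g16.md` §6, end of (P4)).  `stub_coreRateOfEM ⟸ one RateTube.RecordBORatePotInput per L ≥ 2 ⟸ AnalyticRatePotInput.toRecord`.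
Of the four analytic fields, `hN` and `hT` are now theorems for lane A's profile of record: `…ProfileDressingPackageR.profileDressing_package_R` (normaliser, exact mass, dressing, window
identities at radius `r_B`) + `…DressedHTEventuallyR.dressed_hT_eventually_R` (the dressed (B-T) brick at schedule R for any admissible profile of radius `β^{-1/2}btLog β`, given that
package) + the positivity of the profile mass (`…GaussProfileNumbersII.recordProfile_core_floor`).  This file assembles them into ONE existential whose conjuncts are the corresponding
fields of `AnalyticRatePotInput L D M` VERBATIM (with `Ω β u x = n_β(u)·recordProfile L β x`, `r = r_B`, `σ_β = c_β/γ_β`, `C_W = √(1+κ_W/4)`), for every `D ≥ 1` and `M ≥ M₀(L)`.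
What is NOT here: `hST` (lane A's (B-ST) at O(1) precision) and `hODpot` (central quasimode at `η_c = O(β^{-1/3})` + transport colour term in `L²`) — the crux-sized residual of
`stub_coreRateOfEM` — and `stub_shellGainSmall` (lane B).
* `eventually_recordProfile_mass_pos`, ★★★★ `recordProfile_hN_hT`.
HONEST FRAMING: assembly of landed bricks; femto rung R2b1 (RECORD label); not infinite volume, not a gap, not Clay.  No defs, no named facts, no `sorry`.
-/

set_option autoImplicit false

noncomputable section

open MeasureTheory Filter Topology Real
open scoped BigOperators
open Literature.MathematicalPhysics.QuantumFieldTheory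
open Literature.MathematicalPhysics.QuantumLattice

namespace Summit.QuantumFields.YangMills.Theorems.FemtoTransferGap.RateTube

open Summit.QuantumFields.YangMills.Theorems.FemtoTransferGap
open Summit.QuantumFields.YangMills.Theorems.FemtoTransferGap.TwoLattice
open Summit.QuantumFields.YangMills.Theorems.FemtoTransferGap.TwoLattice.ConstTube
open Summit.QuantumFields.YangMills.Theorems.FemtoTransferGap.TwoLattice.Avg
open Summit.QuantumFields.YangMills.Theorems.FemtoTransferGap.TwoLattice.Stiff (LinkSpace)

variable {L : ℕ} [NeZero L]

/-- ★ **The transverse mass of the record profile is eventually positive**: `0 < ∫ recordProfile L β (linkEmbed v) dπ` (core floor `k₀·v_β ≤ ∫_{coreBox}`, `v_β > 0`). [folklore] -/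
theorem eventually_recordProfile_mass_pos : ∀ᶠ β : ℝ in atTop, 0 < ∫ v, recordProfile L β (linkEmbed L v) ∂orthoTransverse L := by
  haveI := isFiniteMeasure_orthoTransverse L
  obtain ⟨hΩm, hΩ01, hCΩ, -⟩ := recordProfile_fields L
  obtain ⟨k₀, β₂, hk₀, hβ₂, hfloor⟩ := recordProfile_core_floor L
  filter_upwards [Filter.eventually_ge_atTop β₂] with β hβ
  have hβ1 : 1 ≤ β := by linarith
  have hint : Integrable (fun v : Edge 3 L → Fin 3 → ℝ => recordProfile L β (linkEmbed L v)) (orthoTransverse L) :=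
    integrable_of_measurable_abs_le (orthoTransverse L) ((hΩm β).comp (measurable_linkEmbed L)) fun v => hCΩ β _
  have h2 : ∫ v in coreBox L β, recordProfile L β (linkEmbed L v) ∂orthoTransverse L ≤ ∫ v, recordProfile L β (linkEmbed L v) ∂orthoTransverse L :=
    setIntegral_le_integral hint (ae_of_all _ fun v => (hΩ01 β _).1)
  exact lt_of_lt_of_le (lt_of_lt_of_le (mul_pos hk₀ (volume_real_sublevel_one_pos L hβ1)) (hfloor β hβ)) h2

set_option maxHeartbeats 1600000 in
/-- ★★★★ **hN AND hT OF THE ANALYTIC RATE INPUT FOR THE PROFILE OF RECORD.**  `L ≥ 2`, `D ≥ 1`.  There is `M₀ ≥ 2` and for every `M ≥ M₀`: a fibre profile `Ω β u x = n_β(u)·recordProfile L β x`,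
a dressing `W`, functions `γ, σ, κ` and constants `κ_W ≥ 0`, `C_W` such that (`n_β` measurable, `0 ≤ n_β ≤ 1`, gauge invariant, and POSITIVE on fibres of positive mass) — conjunct by conjunct the fields `hΩm, hΩ1, hΩinv, hΩr (r = r_B), hWphys, hW0, hWbU, hκW, hWsq, hr, hr_small,
hγ, hσ, hκ0, hκ_small, hN, hT` of `RateTube.AnalyticRatePotInput L D M` — the profile is jointly measurable, bounded by `1`, gauge covariant, supported in `‖x‖ ≤ r_B(β)`; `W_β` is physical,
`0 ≤ W_β ≤ C_W`, `|W_β² − 1| ≤ κ_W·orbitDist²` on the window; `0 ≤ r_B ≤ ½`, `12|Site|·r_B < β^{-1/6}` eventually; `γ, σ > 0`, `0 ≤ κ = O(λ_b(L³β)²)`; EVENTUALLY on the window the fibre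
mass of `Ω β` against `softWeight (recordChi L (1/6) (42D+1) M β)` is within `κ_βγ_β` of `γ_β` (in fact equal), and for every bounded measurable gauge-invariant `φ` supported in the window
`|tubeForm β (boFunAd φ (Ω β)) − σ_βγ_β·Q_{L³β}(φW_β)| ≤ κ_β·(σ_βγ_β)·(Q_{L³β}(φW_β) + λ₀(1,L³β)‖φ‖²)`. [cite: Luscher1983, §3] -/
theorem recordProfile_hN_hT (hL2 : 2 ≤ L) (hL : Nonempty (NzSite L)) {D : ℝ} (hD : 1 ≤ D) :
    ∃ M₀ : ℝ, 2 ≤ M₀ ∧ ∀ M : ℝ, M₀ ≤ M →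
      ∃ (Ω : ℝ → GaugeConfig 3 1 SU2 → LinkSpace L → ℝ) (W : ℝ → GaugeConfig 3 1 SU2 → ℝ) (γ σ κ : ℝ → ℝ) (κW CW : ℝ),
        (∃ n : ℝ → GaugeConfig 3 1 SU2 → ℝ, (∀ β, Measurable (n β)) ∧ (∀ β u, 0 ≤ n β u ∧ n β u ≤ 1) ∧
          (∀ β (g : Site 3 1 → SU2) (u : GaugeConfig 3 1 SU2), n β (gaugeTransform g u) = n β u) ∧
          (∀ β u, 0 < fibreMass L (softWeight (recordChi L (1 / 6) (42 * D + 1) M β)) (recordProfile L β) u → 0 < n β u) ∧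
          Ω = fun β u x => n β u * recordProfile L β x) ∧
        (∀ β, Measurable (Function.uncurry (Ω β))) ∧ (∀ β u x, |Ω β u x| ≤ 1) ∧
        (∀ β (g : SU2) (u : GaugeConfig 3 1 SU2) (v : LinkSpace L), Ω β (gaugeTransform (fun _ : Site 3 1 => g) u) (adL L g v) = Ω β u v) ∧
        (∀ β u x, Ω β u x ≠ 0 → ‖x‖ ≤ min (1 / 40) (powScale (1 / 2) β * btLog β)) ∧
        (∀ β, IsPhys (W β)) ∧ (∀ β u, 0 ≤ W β u) ∧ (∀ β u, |W β u| ≤ CW) ∧ 0 ≤ κW ∧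
        (∀ β u, orbitDist u < D * recordDelta1 L (1 / 6) β → |W β u ^ 2 - 1| ≤ κW * orbitDist u ^ 2) ∧
        (∀ β : ℝ, 0 ≤ min (1 / 40) (powScale (1 / 2) β * btLog β) ∧ min (1 / 40) (powScale (1 / 2) β * btLog β) ≤ 1 / 2) ∧
        (∀ᶠ β : ℝ in atTop, 12 * Fintype.card (Site 3 L) * min (1 / 40) (powScale (1 / 2) β * btLog β) < powScale (1 / 6) β) ∧
        (∀ β, 0 < γ β) ∧ (∀ β, 0 < σ β) ∧ (∀ β, 0 ≤ κ β) ∧ (∃ a : ℝ, ∀ᶠ β in atTop, κ β ≤ a * bareLambda ((L : ℝ) ^ 3 * β) ^ 2) ∧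
        (∀ᶠ β in atTop, ∀ u : GaugeConfig 3 1 SU2, orbitDist u < D * recordDelta1 L (1 / 6) β →
          |fibreMassAd L (softWeight (recordChi L (1 / 6) (42 * D + 1) M β)) (Ω β) u - γ β| ≤ κ β * γ β) ∧
        (∀ᶠ β in atTop, ∀ φ : GaugeConfig 3 1 SU2 → ℝ, Measurable φ → (∃ C : ℝ, ∀ u, |φ u| ≤ C) →
          (∀ (g : Site 3 1 → SU2) (u : GaugeConfig 3 1 SU2), φ (gaugeTransform g u) = φ u) → (∀ u, φ u ≠ 0 → orbitDist u < D * recordDelta1 L (1 / 6) β) →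
          |tubeForm β (boFunAd L φ (Ω β)) - σ β * γ β * qform su2Rep ((L : ℝ) ^ 3 * β) (fun u => φ u * W β u) (fun u => φ u * W β u)| ≤
            κ β * (σ β * γ β) * (qform su2Rep ((L : ℝ) ^ 3 * β) (fun u => φ u * W β u) (fun u => φ u * W β u) + levelValue su2Rep 1 ((L : ℝ) ^ 3 * β) 0 * l2 φ φ)) := by
  have hD0 : 0 ≤ D := zero_le_one.trans hD
  obtain ⟨hΩm, hΩ01, hCΩ, hΩinv⟩ := recordProfile_fields L
  obtain ⟨-, hRsmall, -⟩ := recordRadius_eventually (L := L)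
  obtain ⟨M₀, hM₀, hpk⟩ := profileDressing_package_Rpos hL2 hL hD0
  refine ⟨M₀, hM₀, fun M hM => ?_⟩
  obtain ⟨n, m, W, γ, ε, κ, hκ, hP1, hP2, hP3, hP4, hγpos, hN, hWphys, hW0, hWb, hWsq, hεa, hwin, hn_m, hn01, hn_g, hnpos⟩ := hpk M hM
  -- the dressed (B-T) brick at schedule R for the record profile
  have hΩs : ∀ β (v : Edge 3 L → Fin 3 → ℝ), recordProfile L β (linkEmbed L v) ≠ 0 →
      v ∈ capBalancedSet L ∧ ‖linkEmbed L v‖ ≤ btLog β * powScale (1 / 2) β ∧ ∀ (e : Edge 3 L) (c : Fin 3), |v e c| ≤ btLog β * powScale (1 / 2) β := fun β v hv => by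
    obtain ⟨h1, h2, h3⟩ := recordProfile_support L hv
    refine ⟨h1, h3.trans ((min_le_right _ _).trans (le_of_eq (mul_comm _ _))), fun e c => (h2 e c).trans ((min_le_right _ _).trans (le_of_eq (mul_comm _ _)))⟩
  obtain ⟨c, κT, hc, hκT0, hκTa, hT⟩ := dressed_hT_eventually_R (L := L) hD (Ω₀ := recordProfile L) hΩm (fun β x => (hΩ01 β x).1) (fun β x => (hΩ01 β x).2) hΩinv hΩs
    eventually_recordProfile_mass_pos (n := n) (m := m) (W := W) (εW := ε) (κN := κ) (CW := Real.sqrt (1 + κ / 4)) (κW := κ)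
    hn_m hn01 hn_g hWphys hW0 hWb hκ hκ hWsq hεa hwin
  obtain ⟨Ω, hΩdef⟩ : ∃ Ω : ℝ → GaugeConfig 3 1 SU2 → LinkSpace L → ℝ, Ω = fun β u x => n β u * recordProfile L β x := ⟨_, rfl⟩
  obtain ⟨σ, hσdef⟩ : ∃ σ : ℝ → ℝ, σ = fun β => c β / γ β := ⟨_, rfl⟩
  have hσγ : ∀ β, σ β * γ β = c β := fun β => by rw [hσdef]; exact div_mul_cancel₀ _ (hγpos β).ne'
  have hr : ∀ β : ℝ, 0 ≤ min (1 / 40) (powScale (1 / 2) β * btLog β) ∧ min (1 / 40) (powScale (1 / 2) β * btLog β) ≤ 1 / 2 := fun β =>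
    ⟨le_min (by norm_num) (mul_nonneg (powScale_pos _ _).le (zero_le_one.trans (one_le_btLog β))), (min_le_left _ _).trans (by norm_num)⟩
  refine ⟨Ω, W, γ, σ, κT, κ, Real.sqrt (1 + κ / 4), ⟨n, hn_m, hn01, hn_g, hnpos, hΩdef⟩, fun β => by rw [hΩdef]; exact hP1 β, fun β u x => by rw [hΩdef]; exact hP2 β u x,
    fun β g u v => by rw [hΩdef]; exact hP3 β g u v, fun β u x h => hP4 β u x (by rw [hΩdef] at h; exact h), hWphys, hW0, hWb, hκ, hWsq, hr, hRsmall, hγpos,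
    fun β => by rw [hσdef]; exact div_pos (hc β) (hγpos β), hκT0, hκTa, ?_, ?_⟩
  · filter_upwards [hN] with β h u hu
    rw [hΩdef, h u hu, sub_self, abs_zero]
    exact mul_nonneg (hκT0 β) (hγpos β).le
  · filter_upwards [hT] with β h φ hφm hφb hφg hφs
    rw [hσγ β, hΩdef]
    exact h φ hφm hφb hφg hφs

end Summit.QuantumFields.YangMills.Theorems.FemtoTransferGap.RateTube

end
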